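import Summits.CriticalPhenomena.Ising3D.Control2DReadoutTail
import Mathlib.Tactic.Linarith
import Mathlib.Tactic.Positivity
import Mathlib.Tactic.FieldSimp
import Mathlib.Tactic.Ring
import Mathlib.Tactic.NormNum
import HarnessLib

/-!
# Readout certificates, kernel half: exact rational heads + the two-sided tail bound ⇒ comparisons of the scalar-channel
action of a table functional at finitely many dimensions (cell `pub-ising3x`, seat controls-1 gen 29; KERNEL PATH,
certificate kind "readout" — CONTROL-ONLY)

HONEST FRAMING: lottery ticket; floor = tightest certified 3D Ising CFT bounds; no exact-solution
claim without a proof. CONTROL-ONLY (`d = 2`, `Δ_σ = 1/8`); nothing numerical is asserted here.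

For the integer table `wt` on the index list `Sl` (`φ = taylorFunctional2D (1/2) Sl.toFinset wt`, `Δ_σ = 1/8`) and a rational
dimension `Δ`, the truncated scalar-channel action is an exact rational up to a positive factor:
`φ[F_-[Q_N(Δ,0)]] = (1/2)^{1/4} (1/2)^Δ · headQ` (`taylorFunctional2D_half_crossF_QN` with the ℚ-mirrors `aQ` = `a_m`,
`chooseQ` = `C(α,j)`, `qQ` = `q¹`, `uSumQ` = `u_k`, all by structural recursion — what `decide` evaluates; cast lemmas
`cast_*`), and `Control2DReadoutTail.abs_phi_block0_sub_QN_le` bounds the rest by `(1/2)^{1/4} (1/2)^Δ · errQ` (ℚ-mirrors of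
`absWeight`, `tailMajor`, the kept majorant head; binomials by the ratio recursion, never `Nat.choose`'s Pascal recursion). Hence the
enclosure `blockAction0_mem`: `halfPow Δ · (headQ - errQ) ≤ φ[F_-[g_{Δ,0}]] ≤ halfPow Δ · (headQ + errQ)`. The Boolean check built on
it and its soundness (the displaced-dip inequalities of the T-2 obligation nodes `CFDipΛ`) are `Control2DReadoutCheck`.
Elementary; no facts, standard axioms only. [cite: RattazziEtAl2008, §5.5]
-/

namespace Summit.CriticalPhenomena.Ising3D.Control2D

open Finset Set
open Literature.MathematicalPhysics.QuantumFieldTheory.ConformalBootstrap3D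

/-! ### ℚ-mirrors by structural recursion, with their cast lemmas -/

/-- `Σ_{i<n} f i` over `ℚ` (structural recursion). [folklore] -/
def sumRangeQ (f : ℕ → ℚ) : ℕ → ℚ
  | 0 => 0
  | n + 1 => sumRangeQ f n + f n

/-- [folklore] -/
theorem cast_sumRangeQ (f : ℕ → ℚ) : ∀ n : ℕ, ((sumRangeQ f n : ℚ) : ℝ) = ∑ i ∈ range n, ((f i : ℚ) : ℝ)
  | 0 => by simp [sumRangeQ]
  | n + 1 => by rw [sumRangeQ, Rat.cast_add, cast_sumRangeQ f n, Finset.sum_range_succ]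

/-- The generalized binomial coefficient `C(α, j)` over `ℚ` by the ratio recursion `C(α, j+1) = C(α, j)(α-j)/(j+1)`.
[folklore] -/
def chooseQ (α : ℚ) : ℕ → ℚ
  | 0 => 1
  | j + 1 => chooseQ α j * (α - j) / (j + 1)

/-- `chooseQ α j = C(α, j)` (`Ring.choose` over `ℝ`). [folklore] -/
theorem cast_chooseQ (α : ℚ) : ∀ j : ℕ, ((chooseQ α j : ℚ) : ℝ) = Ring.choose (α : ℝ) j
  | 0 => by simp [chooseQ]
  | j + 1 => by
      have hj : ((j : ℝ) + 1) ≠ 0 := by positivity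
      have hf : ((j.factorial : ℕ) : ℝ) ≠ 0 := by positivity
      rw [chooseQ, Rat.cast_div, Rat.cast_mul, cast_chooseQ α j, choose_eq_descPochhammer_div,
        choose_eq_descPochhammer_div, descPochhammer_succ_eval, Nat.factorial_succ]
      push_cast
      field_simp

/-- At a natural argument `chooseQ` is `Nat.choose`. [folklore] -/
theorem cast_chooseQ_natCast (n j : ℕ) : ((chooseQ (n : ℚ) j : ℚ) : ℝ) = ((n.choose j : ℕ) : ℝ) := by
  rw [cast_chooseQ, Rat.cast_natCast, Ring.choose_natCast]

/-- `q¹(s, α; k) = Σ_{i+j=k} (-1)^i C(s,i) C(α,j)` over `ℚ`. [folklore] -/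
def qQ (s α : ℚ) (k : ℕ) : ℚ :=
  sumRangeQ (fun i => (-1) ^ i * chooseQ s i * chooseQ α (k - i)) (k + 1)

/-- [folklore] -/
theorem cast_qQ (s α : ℚ) (k : ℕ) : ((qQ s α k : ℚ) : ℝ) = qFactor₁ (s : ℝ) (α : ℝ) k := by
  rw [qQ, cast_sumRangeQ, qFactor₁, Finset.Nat.sum_antidiagonal_eq_sum_range_succ_mk]
  refine Finset.sum_congr rfl fun i _ => ?_
  push_cast
  rw [cast_chooseQ, cast_chooseQ]

/-- `a_m(h)` over `ℚ` by the ratio recursion (a faithful mirror of `chiralCoeff` for `h > 0`). [folklore] -/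
def aQ (h : ℚ) : ℕ → ℚ
  | 0 => 1
  | m + 1 => aQ h m * ((h + m) ^ 2 / ((m + 1) * (2 * h + m)))

/-- [folklore] -/
theorem cast_aQ {h : ℚ} (hh : 0 < h) : ∀ m : ℕ, ((aQ h m : ℚ) : ℝ) = chiralCoeff (h : ℝ) m
  | 0 => by
      have hh' : (0 : ℝ) ≤ (h : ℝ) := by exact_mod_cast hh.le
      rw [aQ, chiralCoeff_eq_prod hh']
      simp [chiralProd]
  | m + 1 => by
      have hh' : (0 : ℝ) < (h : ℝ) := by exact_mod_cast hh
      rw [aQ, Rat.cast_mul, cast_aQ hh m, chiralCoeff_eq_prod hh'.le, chiralCoeff_eq_prod hh'.le, chiralProd,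
        chiralProd, Finset.prod_range_succ, chiralFactor_eq_of_pos hh' m]
      push_cast
      ring

/-- The one-pass state `(Σ_{i<m} a_i 2^{-i} q¹(s, h+i; k), a_m 2^{-m})`. [folklore] -/
def uSumGo (s h : ℚ) (k : ℕ) : ℕ → ℚ × ℚ
  | 0 => (0, 1)
  | m + 1 =>
      ((uSumGo s h k m).1 + (uSumGo s h k m).2 * qQ s (h + m) k,
        (uSumGo s h k m).2 * ((h + m) ^ 2 / ((m + 1) * (2 * h + m))) / 2)

/-- `u_k(h) = Σ_{m<N} a_m(h) 2^{-m} q¹(s, h+m; k)` over `ℚ` (one pass). [folklore] -/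
def uSumQ (s h : ℚ) (N k : ℕ) : ℚ := (uSumGo s h k N).1

/-- [folklore] -/
theorem uSumGo_snd (s h : ℚ) (k : ℕ) : ∀ m : ℕ, (uSumGo s h k m).2 = aQ h m * (1 / 2) ^ m
  | 0 => by simp [uSumGo, aQ]
  | m + 1 => by rw [uSumGo, uSumGo_snd s h k m, aQ, pow_succ]; ring

/-- [folklore] -/
theorem uSumGo_fst (s h : ℚ) (k : ℕ) :
    ∀ m : ℕ, (uSumGo s h k m).1 = sumRangeQ (fun i => aQ h i * (1 / 2) ^ i * qQ s (h + i) k) m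
  | 0 => by simp [uSumGo, sumRangeQ]
  | m + 1 => by rw [uSumGo, uSumGo_fst s h k m, uSumGo_snd s h k m, sumRangeQ]

/-- `uSumQ` is the tree's `uSum` (for `h > 0`). [folklore] -/
theorem cast_uSumQ (s : ℚ) {h : ℚ} (hh : 0 < h) (N k : ℕ) :
    ((uSumQ s h N k : ℚ) : ℝ) = uSum (s : ℝ) N (h : ℝ) k := by
  rw [uSumQ, uSumGo_fst, cast_sumRangeQ, uSum]
  refine Finset.sum_congr rfl fun i _ => ?_
  push_cast
  rw [cast_aQ hh, cast_qQ]
  push_cast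
  ring

/-- All `q¹(s, α; k)`, `k = 0..Λ`. [folklore] -/
def qVecQ (s α : ℚ) (Λ : ℕ) : List ℚ := (List.range (Λ + 1)).map (qQ s α)

/-- ONE pass over the `z`-series levels for ALL derivative orders `k ≤ Λ` at once (the state is the vector of partial sums and
`a_m 2^{-m}`); this is the form the kernel evaluates (each level's chiral data shared by all `k`). [folklore] -/
def uVecGo (s h : ℚ) (Λ : ℕ) : ℕ → List ℚ × ℚ
  | 0 => (List.replicate (Λ + 1) 0, 1)
  | m + 1 =>
      (List.zipWith (fun x q => x + (uVecGo s h Λ m).2 * q) (uVecGo s h Λ m).1 (qVecQ s (h + m) Λ),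
        (uVecGo s h Λ m).2 * ((h + m) ^ 2 / ((m + 1) * (2 * h + m))) / 2)

/-- The vector `[u_0(h), …, u_Λ(h)]` (`N` levels). [folklore] -/
def uVecQ (s h : ℚ) (N Λ : ℕ) : List ℚ := (uVecGo s h Λ N).1

/-- [folklore] -/
theorem uVecGo_snd (s h : ℚ) (Λ k : ℕ) : ∀ m : ℕ, (uVecGo s h Λ m).2 = (uSumGo s h k m).2
  | 0 => by simp [uVecGo, uSumGo]
  | m + 1 => by rw [uVecGo, uSumGo, uVecGo_snd s h Λ k m]

/-- The one-pass vector agrees entry by entry with the per-order sums. [folklore] -/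
theorem uVecGo_getElem? (s h : ℚ) (Λ : ℕ) {k : ℕ} (hk : k ≤ Λ) :
    ∀ m : ℕ, ((uVecGo s h Λ m).1)[k]? = some ((uSumGo s h k m).1)
  | 0 => by
      simp only [uVecGo, uSumGo]
      rw [List.getElem?_replicate]
      simp [Nat.lt_succ_of_le hk]
  | m + 1 => by
      have ih := uVecGo_getElem? s h Λ hk m
      have hq : (qVecQ s (h + m) Λ)[k]? = some (qQ s (h + m) k) := by
        unfold qVecQ
        rw [List.getElem?_map, List.getElem?_range (Nat.lt_succ_of_le hk)]
        rfl
      rw [uVecGo, uSumGo, List.getElem?_zipWith, ih, hq, uVecGo_snd s h Λ k m]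

/-- [folklore] -/
theorem uVecQ_getD (s h : ℚ) (N Λ : ℕ) {k : ℕ} (hk : k ≤ Λ) : (uVecQ s h N Λ)[k]?.getD 0 = uSumQ s h N k := by
  rw [uVecQ, uVecGo_getElem? s h Λ hk N, uSumQ]
  rfl

/-- The parity weight `c_p` over `ℚ`. [folklore] -/
def cfacQ (p : ℕ × ℕ) : ℚ := (1 - (-1) ^ (p.1 + p.2)) * 2 ^ (p.1 + p.2)

/-- [folklore] -/
theorem cast_cfacQ (p : ℕ × ℕ) : ((cfacQ p : ℚ) : ℝ) = cfac p := by
  unfold cfacQ cfac; push_cast; ring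

/-- **The rational head**: `Σ_{p ∈ Sl} wt_p c_p · 2 u_{p₁}(h) u_{p₂}(h)` (scalar channel: `h = h̄ = Δ/2`). [folklore] -/
def headQ (wt : ℕ × ℕ → ℤ) (Sl : List (ℕ × ℕ)) (s h : ℚ) (N : ℕ) : ℚ :=
  (Sl.map fun p => (wt p : ℚ) * cfacQ p * (2 * (uSumQ s h N p.1 * uSumQ s h N p.2))).sum

/-- [folklore] -/
theorem cast_headQ (wt : ℕ × ℕ → ℤ) {Sl : List (ℕ × ℕ)} (hnd : Sl.Nodup) (s : ℚ) {h : ℚ} (hh : 0 < h) (N : ℕ) :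
    ((headQ wt Sl s h N : ℚ) : ℝ) =
      ∑ p ∈ Sl.toFinset, (wt p : ℝ) * cfac p *
        (uSum (s : ℝ) N (h : ℝ) p.1 * uSum (s : ℝ) N (h : ℝ) p.2 +
          uSum (s : ℝ) N (h : ℝ) p.1 * uSum (s : ℝ) N (h : ℝ) p.2) := by
  rw [headQ, List.sum_toFinset _ hnd, Rat.cast_list_sum, List.map_map]
  congr 1
  refine List.map_congr_left fun p _ => ?_
  simp only [Function.comp_apply]
  push_cast
  rw [cast_cfacQ, cast_uSumQ s hh, cast_uSumQ s hh]
  ring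

/-- **The rational head, one-pass form** (what the kernel evaluates): the `u`-vector is computed once and looked up. [folklore] -/
def headQv (wt : ℕ × ℕ → ℤ) (Sl : List (ℕ × ℕ)) (s h : ℚ) (N Λ : ℕ) : ℚ :=
  let us := uVecQ s h N Λ
  (Sl.map fun p => (wt p : ℚ) * cfacQ p * (2 * (us[p.1]?.getD 0 * us[p.2]?.getD 0))).sum

/-- [folklore] -/
theorem headQv_eq_headQ (wt : ℕ × ℕ → ℤ) {Sl : List (ℕ × ℕ)} {Λ : ℕ} (hdeg : ∀ p ∈ Sl, p.1 + p.2 ≤ Λ)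
    (s h : ℚ) (N : ℕ) : headQv wt Sl s h N Λ = headQ wt Sl s h N := by
  dsimp only [headQv, headQ]
  congr 1
  refine List.map_congr_left fun p hp => ?_
  have h1 : p.1 ≤ Λ := by have := hdeg p hp; omega
  have h2 : p.2 ≤ Λ := by have := hdeg p hp; omega
  simp only [uVecQ_getD s h N Λ h1, uVecQ_getD s h N Λ h2]

/-- The absolute weight `W = Σ |wt_p| c_p` over `ℚ`. [folklore] -/
def absWeightQ (wt : ℕ × ℕ → ℤ) (Sl : List (ℕ × ℕ)) : ℚ := (Sl.map fun p => |(wt p : ℚ)| * cfacQ p).sum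

/-- [folklore] -/
theorem cast_absWeightQ (wt : ℕ × ℕ → ℤ) {Sl : List (ℕ × ℕ)} (hnd : Sl.Nodup) :
    ((absWeightQ wt Sl : ℚ) : ℝ) = absWeight Sl.toFinset (fun p => (wt p : ℝ)) := by
  rw [absWeightQ, absWeight, List.sum_toFinset _ hnd, Rat.cast_list_sum, List.map_map]
  congr 1
  refine List.map_congr_left fun p _ => ?_
  simp only [Function.comp_apply]
  push_cast
  rw [cast_cfacQ]

/-- `tailMajor Λ M` over `ℚ` (binomial by the ratio recursion). [folklore] -/
def tailMajorQ (Λ M : ℕ) : ℚ :=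
  (1 / 2) ^ M * chooseQ ((M + Λ : ℕ) : ℚ) Λ * ((2 * ((M : ℚ) + 1)) / ((M : ℚ) + 1 - Λ))

/-- [folklore] -/
theorem cast_tailMajorQ (Λ M : ℕ) : ((tailMajorQ Λ M : ℚ) : ℝ) = tailMajor Λ M := by
  rw [tailMajorQ, tailMajor, Rat.cast_mul, Rat.cast_mul, cast_chooseQ_natCast]
  push_cast; ring

/-- The kept head `S_N = Σ_{m<N} 2^{-m} C(m+Λ+4, Λ)` of the majorant series over `ℚ`. [folklore] -/
def headMajor4Q (Λ N : ℕ) : ℚ := sumRangeQ (fun m => (1 / 2) ^ m * chooseQ ((m + Λ + 4 : ℕ) : ℚ) Λ) N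

/-- [folklore] -/
theorem cast_headMajor4Q (Λ N : ℕ) :
    ((headMajor4Q Λ N : ℚ) : ℝ) = ∑ m ∈ range N, (1 / 2 : ℝ) ^ m * (((m + Λ + 4).choose Λ : ℕ) : ℝ) := by
  rw [headMajor4Q, cast_sumRangeQ]
  refine Finset.sum_congr rfl fun m _ => ?_
  rw [Rat.cast_mul, cast_chooseQ_natCast]
  push_cast; ring

/-- **The rational error radius** `2W · A² · σ(2 S_N + σ)` of `abs_phi_block0_sub_QN_le` (`A = max 1 (Δ/4)`, `σ = 16 τ`). [folklore] -/
def errQ (wt : ℕ × ℕ → ℤ) (Sl : List (ℕ × ℕ)) (Δ : ℚ) (N Λ : ℕ) : ℚ :=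
  2 * absWeightQ wt Sl * (max 1 (Δ / 4)) ^ 2 *
    ((16 * tailMajorQ Λ (N + 4)) * (2 * headMajor4Q Λ N + 16 * tailMajorQ Λ (N + 4)))

/-- [folklore] -/
theorem cast_errQ (wt : ℕ × ℕ → ℤ) {Sl : List (ℕ × ℕ)} (hnd : Sl.Nodup) (Δ : ℚ) (N Λ : ℕ) :
    ((errQ wt Sl Δ N Λ : ℚ) : ℝ) =
      2 * absWeight Sl.toFinset (fun p => (wt p : ℝ)) * (max 1 ((Δ : ℝ) / 4)) ^ 2 *
        ((16 * tailMajor Λ (N + 4)) *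
          (2 * (∑ m ∈ range N, (1 / 2 : ℝ) ^ m * (((m + Λ + 4).choose Λ : ℕ) : ℝ)) + 16 * tailMajor Λ (N + 4))) := by
  rw [errQ]; push_cast; rw [cast_absWeightQ wt hnd, cast_tailMajorQ, cast_headMajor4Q]

/-! ### The enclosure of the scalar-channel action at a rational dimension -/

/-- The positive factor `(1/2)^{1/4} (1/2)^Δ` (`Δ_σ = 1/8`). [folklore] -/
noncomputable def halfPow (Δ : ℝ) : ℝ := (1 / 2 : ℝ) ^ (1 / 8 : ℝ) * (1 / 2 : ℝ) ^ (1 / 8 : ℝ) * (1 / 2 : ℝ) ^ Δ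

/-- [folklore] -/
theorem halfPow_pos (Δ : ℝ) : 0 < halfPow Δ := by
  unfold halfPow
  have h1 : (0 : ℝ) < (1 / 2 : ℝ) ^ (1 / 8 : ℝ) := Real.rpow_pos_of_pos (by norm_num) _
  have h2 : (0 : ℝ) < (1 / 2 : ℝ) ^ Δ := Real.rpow_pos_of_pos (by norm_num) _
  positivity

/-- `halfPow` is strictly antitone. [folklore] -/
theorem halfPow_lt_halfPow {x y : ℝ} (hxy : x < y) : halfPow y < halfPow x := by
  unfold halfPow
  have h1 : (0 : ℝ) < (1 / 2 : ℝ) ^ (1 / 8 : ℝ) := Real.rpow_pos_of_pos (by norm_num) _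
  have h := Real.rpow_lt_rpow_of_exponent_gt (by norm_num : (0 : ℝ) < 1 / 2) (by norm_num : (1 / 2 : ℝ) < 1) hxy
  exact mul_lt_mul_of_pos_left h (mul_pos h1 h1)

/-- `halfPow b ≥ halfPow m / 2` for `b ≤ m + 1`. [folklore] -/
theorem halfPow_ge_half {m b : ℝ} (hb : b ≤ m + 1) : halfPow m / 2 ≤ halfPow b := by
  unfold halfPow
  have h1 : (0 : ℝ) < (1 / 2 : ℝ) ^ (1 / 8 : ℝ) := Real.rpow_pos_of_pos (by norm_num) _
  have hle : (1 / 2 : ℝ) ^ (m + 1) ≤ (1 / 2 : ℝ) ^ b :=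
    Real.rpow_le_rpow_of_exponent_ge (by norm_num) (by norm_num) hb
  rw [Real.rpow_add (by norm_num : (0 : ℝ) < 1 / 2), Real.rpow_one] at hle
  have : (1 / 2 : ℝ) ^ (1 / 8 : ℝ) * (1 / 2 : ℝ) ^ (1 / 8 : ℝ) * (1 / 2 : ℝ) ^ m / 2 =
      (1 / 2 : ℝ) ^ (1 / 8 : ℝ) * (1 / 2 : ℝ) ^ (1 / 8 : ℝ) * ((1 / 2 : ℝ) ^ m * (1 / 2)) := by ring
  rw [this]
  exact mul_le_mul_of_nonneg_left hle (mul_pos h1 h1).le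

/-- **Enclosure of the scalar-channel action at a rational dimension** (`Δ_σ = 1/8`, scalar channel `ℓ = 0`): for the integer
table `wt` on the duplicate-free index list `Sl` (all `p₁ + p₂ ≤ Λ`), `0 < Δ ≤ 6`, `Δ(Δ-4) ≤ 4`, `Λ < N + 5`:
`halfPow Δ · (headQ - errQ) ≤ φ[F_-[g_{Δ,0}]] ≤ halfPow Δ · (headQ + errQ)`. [cite: RattazziEtAl2008, §5.5] -/
theorem blockAction0_mem (wt : ℕ × ℕ → ℤ) {Sl : List (ℕ × ℕ)} (hnd : Sl.Nodup) {Λ : ℕ}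
    (hdeg : ∀ p ∈ Sl, p.1 + p.2 ≤ Λ) {Δ : ℚ} (hΔ0 : 0 < Δ) (hΔ6 : Δ ≤ 6) (hΔq : Δ * (Δ - 4) ≤ 4)
    {N : ℕ} (hN : Λ < N + 5) :
    halfPow (Δ : ℝ) * (((headQ wt Sl (1 / 8) (Δ / 2) N - errQ wt Sl Δ N Λ : ℚ) : ℝ)) ≤
        taylorFunctional2D (1 / 2) Sl.toFinset (fun p => (wt p : ℝ)) (crossF (1 / 8) (-1) (globalBlock (Δ : ℝ) 0)) ∧
      taylorFunctional2D (1 / 2) Sl.toFinset (fun p => (wt p : ℝ)) (crossF (1 / 8) (-1) (globalBlock (Δ : ℝ) 0)) ≤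
        halfPow (Δ : ℝ) * (((headQ wt Sl (1 / 8) (Δ / 2) N + errQ wt Sl Δ N Λ : ℚ) : ℝ)) := by
  set φ := taylorFunctional2D (1 / 2) Sl.toFinset (fun p => (wt p : ℝ)) with hφ
  have hΛ : ∀ p ∈ Sl.toFinset, p.1 ≤ Λ ∧ p.2 ≤ Λ := by
    intro p hp
    have := hdeg p (List.mem_toFinset.mp hp)
    exact ⟨by omega, by omega⟩
  have hΔR0 : (0 : ℝ) < (Δ : ℝ) := by exact_mod_cast hΔ0
  have hΔR6 : (Δ : ℝ) ≤ 6 := by exact_mod_cast hΔ6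
  have hΔRq : (Δ : ℝ) * ((Δ : ℝ) - 4) ≤ 4 := by exact_mod_cast hΔq
  -- the tail bound
  have htail := abs_phi_block0_sub_QN_le Sl.toFinset (fun p => (wt p : ℝ)) (s := 1 / 8) (by norm_num) (by norm_num)
    hΛ hΔR0.le hΔR6 hΔRq hN
  -- the head in closed form
  have hℓ : ((0 : ℕ) : ℝ) ≤ (Δ : ℝ) := by simpa using hΔR0.le
  have hhead := taylorFunctional2D_half_crossF_QN Sl.toFinset (fun p => (wt p : ℝ)) (1 / 8 : ℝ) hℓ N
  have e1 : ((Δ : ℝ) + ((0 : ℕ) : ℝ)) / 2 = (((Δ / 2 : ℚ)) : ℝ) := by push_cast; ring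
  have e2 : ((Δ : ℝ) - ((0 : ℕ) : ℝ)) / 2 = (((Δ / 2 : ℚ)) : ℝ) := by push_cast; ring
  rw [e1, e2] at hhead
  have hh : (0 : ℚ) < Δ / 2 := by linarith
  have hH := cast_headQ wt hnd (1 / 8) hh N
  have hs8 : (((1 / 8 : ℚ)) : ℝ) = 1 / 8 := by norm_num
  rw [hs8] at hH
  rw [← hH] at hhead
  -- assemble
  have hE := cast_errQ wt hnd Δ N Λ
  have hP : halfPow (Δ : ℝ) = (1 / 2 : ℝ) ^ (1 / 8 : ℝ) * (1 / 2 : ℝ) ^ (1 / 8 : ℝ) * (1 / 2 : ℝ) ^ (Δ : ℝ) := rfl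
  rw [hhead] at htail
  have hbound : |φ (crossF (1 / 8) (-1) (globalBlock (Δ : ℝ) 0)) -
      halfPow (Δ : ℝ) * ((headQ wt Sl (1 / 8) (Δ / 2) N : ℚ) : ℝ)| ≤
      halfPow (Δ : ℝ) * ((errQ wt Sl Δ N Λ : ℚ) : ℝ) := by
    rw [hE, hP]
    refine htail.trans (le_of_eq ?_)
    ring
  obtain ⟨h1, h2⟩ := abs_le.mp hbound
  push_cast
  constructor <;> nlinarith [h1, h2]

end Summit.CriticalPhenomena.Ising3D.Control2D
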